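import Mathlib
import HarnessLib
import HarnessLib.Audit
import Summits.ABC.Statement
import Literature.NumberTheory.EllipticCurves.Szpiro
import Literature.NumberTheory.DiophantineGeometry.Conductor
import Literature.NumberTheory.DiophantineGeometry.MinimalDiscriminant
import HarnessLib.Audit.Status.Attr

/-!
Route: TwoSixPencil

# Route TwoSixPencil — The general k-cusp pencil theorem — Szpiro exponent 1/k; ℤ/2×ℤ/6 ↦ 1/6, the
rational-cusp ceiling over ℚ

X = TwoSixClassEpsShape ∧ TwoSixResidual ("it suffices to show"). TwoSixClassEpsShape (THE CLASS
THEOREM, unconditional target): for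
every ε > 0 there is C such that every elliptic curve E/ℚ with full rational 2-torsion and a
rational point of order six (torsion
ℤ/2×ℤ/6; Kubert's one-parameter family, integral model W(u,w) = ⟨u²+2uw−19w², 2w(u−5w)(u−w)²,
2w(u−5w)(u−w)²(u−3w)(u+3w), 0, 0⟩,
gcd(u,w) = 1, F(u,w) = w(u−w)(u−3w)(u+3w)(u−5w)(u−9w) ≠ 0) satisfies log|Δ_min(E)| ≤ C·N_E^(1/6+ε).
TwoSixResidual (DECLARED RESIDUAL,
never claimed): abc off the class theorem. The ENGINE is ONE general theorem PencilBound: for ANY k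
≥ 3 pairwise non-proportional
integral linear forms L_1..L_k and coprime (u,w), log max(|u|,|w|) ≪_ε rad(∏ L_i(u,w))^(1/k+ε) — it
serves every rational-cusp class at
once (k = 3: Frey/Legendre, ℤ/4, ℤ/7, ℤ/9; k = 4: ℤ/6 (LINE g4-1, route RationalCuspPencil), ℤ/8,
ℤ/10, ℤ/2×ℤ/4, ℤ/2×ℤ/8; k = 6: ℤ/12 via
(σ,τ) = (u(u−w), w²) and ℤ/2×ℤ/6), and k = 6 is the largest rational cusp count of a genus-0 modular
curve X₁(M,N)/X₀(N) over ℚ, so 1/6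
is this lever's ceiling. Card realised: rational-cusp-pencil. HONESTY: no summit is proved by this
line; the class theorem is NOT abc,
NOT A-PS (POLY-SZPIRO(E)), NOT rung A1′; typed ≠ proved; computed ≠ proved (jobs
j296214/j296255/j296935 are checks, not proofs).
Lean: `TwoSixClassEpsShape ∧ (TwoSixClassEpsShape → _root_.ABC)`

## Assembly
Pure logic: closes (h₁ : PencilBound) (h₂ : TwoSixDictionary) (h₃ : TwoSixPayoff) (h₄ :
TwoSixResidual) : _root_.ABC := h₄ (h₃ h₁ h₂).
The class theorem TwoSixClassEpsShape = h₃ h₁ h₂ is the unconditional content; h₄ is the declared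
residual.

Rationale: WHY THIS LINE. Mechanism (dictionary import, explicit and checkable): CUSPS ARE FORCED BAD PRIMES —
on the ℤ/2×ℤ/6 family the six rational cusps of
X₁(2,6) are the six linear forms of F, Δ(W(u,w)) = 64·w⁶(u−w)⁶(u−3w)²(u+3w)²(u−5w)⁶(u−9w)² exactly
(job j296935), and for p ≥ 5 dividing a
cusp form p ∤ c₄ (Res_u(c₄, L) = ±w⁸·(2,3-unit) for each of the five non-w forms, c₄(u,0) = u⁸), so
the model is minimal and multiplicative
at p with f_p = 1 (tree lemma WeierstrassCurve.conductorExponent_eq_one_of_dvd_Δ_of_not_dvd_c₄,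
pattern of twoTorsionDictionary_proof):
rad F | 6·N_E and |Δ_min| ≤ |Δ(W)| ≤ 64·(10·max(|u|,|w|))²⁴. The abc-side engine is Stewart–Yu 2001
Theorem 2 (StewartYu2001; PROVED in
the tree, Summit.ABC.ABC.Theorems.stewartYu2001_thm2_holds, ε-form
StewartYu2001.log_lt_const_mul_pmin_mul_rpow, p′ = min of the three
greatest prime factors): every member L_i lies in a three-term identity with two other members
(three binary linear forms are dependent),
so log max(|u|,|w|) ≤ K·P(L_i)·R^ε for EVERY i, and a prime above the resultants divides at most one
member, so min_i P(L_i)^k ≤ ∏ P(L_i)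
≤ c·R: exponent 1/k (the k-member form of the tree's StewartYu2001.pmin_pow_three_le_rad;
Sheppard2016 §2.4). Imported: modular units /
Tate normal forms (Kubert1976 Table 3; local data arXiv:2001.01016) ↦ S-unit equations over the
FIXED field ℚ (EvertseGyory2015 ch. 4, 9;
GyoryYu2006; the greatest-prime-factor-of-binary-forms tradition Coates 1970 / Győry 1979 gives
P(F(u,w)) → ∞, not a radical exponent).
Versus listed routes: RationalCuspPencil (own LINE g4-1) types only k = 4 with the ℤ/6 dictionary —
this line types the GENERAL pencil
theorem (all k, all forms: one crux serving every class) and realises the ceiling case k = 6;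
GaussianTwoDivision / AntisymmetricTwoTorsion
use the 2-division FIELD (exponent 2/3, subexp) — here everything stays over ℚ;
PadicPrimesKummerThird / StewartYu rungs are all-triples
ε-shapes ≥ 1/3; print has exponent 1+ε for all curves (MurtyPasten2013), 1/3 on the Frey locus,
densities by torsion (arXiv:2407.13850)
and lower bounds by torsion (arXiv:2104.10817) — no worst-case exponent below 1/3 on any torsion
class.

RANKED CRUXES. #0 TwoSixClassEpsShape (target) — Szpiro's conjecture in ε-shape with exponent 1/6
for every elliptic curve over ℚ with torsion subgroup containing ℤ/2×ℤ/6, stated on the integral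
Kubert model W(u,w) = ⟨u²+2uw−19w², 2w(u−5w)(u−w)², 2w(u−5w)(u−w)²(u−3w)(u+3w), 0, 0⟩ with gcd(u,w)
= 1 and F(u,w) ≠ 0 (every such curve is ℚ-isomorphic to one W(u,w), Kubert1976 Table 3 — semantic,
not load-bearing). (why it might fail: only through the items below: a cusp prime p ≥ 5 at which
W(u,w) were additive or non-minimal (excluded: c₄-resultants are w⁸ times 2,3-units, job j296935),
or a mis-normalised sub-triple in the pencil engine; samples (2,1),(11,4) have torsion [6,2] and rad
F | 6N.) [Kubert1976, StewartYu2001, arXiv:2001.01016, arXiv:2407.13850]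
#2 PencilBound (crux) — THE GENERAL PENCIL THEOREM (abc side, integers only): for every k ≥ 3, all
integer coefficient vectors a, b : Fin k → ℤ with the forms L_i = a_i u + b_i w pairwise
non-proportional, and every ε > 0, there is C with log max(|u|,|w|) ≤ C·rad(∏_i L_i(u,w))^(1/k+ε)
for all coprime u, w with ∏ L_i(u,w) ≠ 0 (card items K1/K1′ in one statement; k = 3 is the tree's
EpsShapeBound(1/3), k = 4 is PencilFourBound of route RationalCuspPencil). [difficulty: M] (why it
might fail: Low risk (corollary of the PROVED Thm 2), all in the Fin k bookkeeping: each member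
needs a 3-term identity with bounded gcd (divides a resultant product), sign/z>2 normalisation with
max(|u|,|w|) ≤ c·z, and P(rescaled member) ≤ max(P(res), P(L_i)).) [StewartYu2001, GyoryYu2006,
EvertseGyory2015, Sheppard2016]
#3 TwoSixResidual (crux) — DECLARED RESIDUAL (never claimed, exempt from staffing credit): the abc
conjecture given the ℤ/2×ℤ/6 class theorem — abc off the class. Booked so that the deciding theorem
reaches the Statement decl; to be narrowed to the ε-column rung for elliptic curves
(SzpiroExponentBelowOne / SzpiroEpsShape (1/6)) off the class once that rung is a registered closer.
[deps: TwoSixClassEpsShape] [difficulty: open-problem] (why it might fail: It is abc itself modulo a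
provable class lemma: every catalogued barrier (BakerMethodBounds, EpsilonCannotBeDropped) stands in
front of it; honest label RESIDUAL = the summit, open.) [MurtyPasten2013, StewartYu2001]
#9 TwoSixDictionary (support) — THE ℤ/2×ℤ/6 DICTIONARY (Tate's algorithm away from 6 on the Kubert
model): for coprime u, w with F(u,w) ≠ 0 and W = W(u,w) elliptic, |Δ_min(W)| ≤
|64·w⁶(u−w)⁶(u−3w)²(u+3w)²(u−5w)⁶(u−9w)²| (= |Δ(W)|, exact identity, job j296935) and rad F ∣ 6·N_W
(p ≥ 5, p | L_i ⇒ p ∤ c₄ since Res_u(c₄, L_i) = ±2^a3^b·w⁸ and c₄(u,0) = u⁸ ⇒ minimal,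
multiplicative, f_p = 1: tree lemma
WeierstrassCurve.conductorExponent_eq_one_of_dvd_Δ_of_not_dvd_c₄; integral model ⇒ |Δ_min| ≤ |Δ| as
in twoTorsionDictionary_proof). [difficulty: provable-now] [SilvermanAEC2009, Kubert1976,
arXiv:2001.01016]
#9 TwoSixPayoff (support) — PAYOFF (real-analysis glue): PencilBound at k = 6 with a =
(0,1,1,1,1,1), b = (1,−1,−3,3,−5,−9) (Fin.prod_univ_six identifies ∏ L_i with F) and the dictionary
give the class theorem: log|Δ_min| ≤ log 64 + 24·(log 10 + log max(|u|,|w|)) ≤ c + 24·C·(6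
N_W)^(1/6+ε) ≤ C'·N_W^(1/6+ε) (N_W ≥ 1). [difficulty: provable-now] [StewartYu2001,
SilvermanAEC2009]

TWO-LAYER PLAN. Split foreseen (BC3 skeleton bc/PencilBound_birth.lean, composition PencilBound_of
kernel-checked): stub_perTermK (per-member Stewart–Yu
transfer, size M) → stub_minMemberK (some member has P ≤ K₀·R^(1/k), elementary) → PencilBound.
Foreseen once PencilBound closes: (i)
the ℤ/12 dictionary in the variables (σ,τ) = (u(u−w), w²) (forms σ, τ, 4σ+τ, 2σ+τ, 3σ+τ, 6σ+τ; job
j296255) ⇒ exponent 1/6 on ℤ/12; (ii)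
TWIST CLOSURE of the ℤ/2×ℤ/6 class (quadratic twists by squarefree d keep full 2-torsion but not the
6-torsion point; twisted model
⟨0, d·B₂, 0, 8d²·B₄, 16d³·B₆⟩ has Δ = 2¹⁸d⁶·(Δ₀/64) and rad(dF) | 6N in 37/37 random checks, job
j296935) — needs the minimality criterion
v_p(c₄) < 4 ⇒ minimal at additive twist primes, not yet in the tree (only unit-Δ and c₄-unit
criteria are) — layer 2; (iii) the X₀(12)
isogeny class (6 rational cusps) once its Hauptmodul j-map is typed.

KILL CRITERIA. A kernel refutation of PencilBound (impossible unless mis-typed: for each k it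
follows from the proved stewartYu2001_thm2; a refuter
should first test k = 3 against epsShapeBound_third_holds and the degenerate data — an
identically-zero form makes ∏ = 0 and is excluded
by the hypothesis ∏ ≠ 0; k with Fin k empty is excluded by 3 ≤ k) or of TwoSixDictionary (a cusp
prime p ≥ 5 with f_p ≠ 1 on W(u,w))
closes the route refuted:<Decl>. A proof of PencilFourBound (route RationalCuspPencil) does not moot
PencilBound (k = 6 is needed here);
SzpiroEpsShape(1/6) for all E/ℚ or abc moots the class theorem. The residual is never a kill
criterion (declared).

NOT DECOMPOSED YET. The per-member normalisation constants over Fin k (gcds dividing resultant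
products, signs, the z > 2 threshold, members equal to ±u
or ±w), the prime-2,3 bookkeeping of the dictionary (absorbed in the factor 6), the ℤ/12 and X₀(12)
instances and the twist closure —
layer-2 children, later.

CHEAPEST FALSIFIER. One PARI loop: for coprime (u,w) in a box with F(u,w) ≠ 0, elltors(W(u,w)) ⊇
[6,2], N_W vs rad F away from 2,3 (must divide), and
|Δ_min| ≤ |Δ(W)|. RUN (job j296935): Δ(W) = 64·w⁶(u−w)⁶(u−3w)²(u+3w)²(u−5w)⁶(u−9w)² identically ✓;
(u,w) = (2,1): torsion [6,2],
N = 2·3·5·7 ✓ (forms 1,1,−1,5,−3,−7); (11,4): torsion [6,2], Szpiro ratio 5.91, rad F | 6N ✓; 10/10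
box samples rad F | 6N ✓, |Δ_min| ≤ |Δ(W)|
✓. The instrument row that would refute the key lemma: a coprime (u,w) and a prime p ≥ 5 with p |
F(u,w), p ∤ N_W — none exists by the
c₄-resultants; ENG can scan |u|,|w| ≤ 10⁴. For PencilBound: k = 3, forms (u, w, u+w) must reproduce
EpsShapeBound(1/3) (tree theorem).

NUMBERS. All-curves record: log|Δ_min| ≪_ε N^(1+ε) (MurtyPasten2013); Frey locus 1/3 (StewartYu2001
Thm 1 / tree epsShapeBound_third_holds);
ℤ/6 class 1/4 (LINE g4-1, open item PencilFourBound). This line: 1/6 on ℤ/2×ℤ/6 (and ℤ/12 foreseen)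
— the smallest exponent the
rational-cusp lever can give over ℚ (max 6 rational cusps on genus-0 X₁(M,N), X₀(N): cusp counts job
j296214 and #{d | N : gcd(d,N/d) ≤ 2}).
Typical value: Szpiro ratio ≈ β_G for almost all curves with torsion G (arXiv:2407.13850 Thm 1.4);
sample (11,4): 5.91.

DEFINITION REQUESTS. None: WeierstrassCurve.minimalDiscriminantNorm / conductorNorm
(Literature.NumberTheory.DiophantineGeometry), UniqueFactorizationMonoid.radical,
Literature.Barriers.ABC.largestPrimeFactor all exist; PencilBound is stated over Fin k → ℤ with
Finset.prod.

Novelty: Searches (2026-08-28): lit search --hybrid "radical of values of a binary form with rational linear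
factors effective lower bound Stewart Yu" (8 books:
[corpus:book:evertse2015-unit-equations-diophantine-number-theory p.90] Coates 1969/70 greatest
prime factor of a binary form ⇒ effective S-unit equations over ℚ, p.223 effective decomposable-form
bounds; [corpus:book:evertse2022-effective-results-methods-diophantine-equations-over-finitely
p.176,186]; Baker 1975 p.123; Sprindžuk 1993 p.172 — all bound P(F(u,w)) from below by log log
H-type quantities or solve Thue–Mahler with FIXED S, none states a radical exponent 1/k); lit search
"binary forms radical abc effective Gyory Yu decomposable" (crossref 8:
[graph:doi:10.4064/aa170828-7-3] Bugeaud–Evertse–Győry 2018 S-parts of values of binary forms (fixed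
S), doi:10.5486/pmd.2019.8557 Győry 2019 bounds for S-unit / decomposable form equations II,
doi:10.5486/pmd.2022.9431 Győry 2022 S-unit equations and Masser's ABC in number fields; OpenAlex/S2
HTTP 429 not dialled); lit galaxy search "binary form|decomposable form|greatest prime factor of"
--star pdf (8 substring junk hits, 0 relevant); plus the LINE g4-1 searches of this session (Barrios
minimal discriminants arXiv:2001.01016; modified Szpiro ratio arXiv:2104.10817, arXiv:2407.13850,
arXiv:2204.10950; "Szpiro torsion" zbMATH 25 rows none relevant; galaxy "Szpiro|torsion point",
"modular unit|S-unit" --star all 0 relevant); lean search / rg over Theses: only RationalCuspPencil  [refs: 10.4064/aa170828-7-3, 10.5486/pmd.2019.8557, 10.5486/pmd.2022.9431, 2001.01016, 2104.10817, 2407.13850, 2204.10950, book:evertse2015-unit-equations-diophantine-number-theory, book:evertse2022-effective-results-methods-diophantine-equations-over-finitely, doi:10.4064/aa170828-7-3, doi:10.5486/pmd.2019.8557, doi:10.5486/pmd.2022.9431, StewartYu2001, GyoryYu2006]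

Barriers (technique_class: dictionary-import, baker-lfl, modular-units): - technique_class: dictionary-import, baker-lfl, modular-units
- Literature.Barriers.ABC.BakerMethodBounds: INSIDE the class (the engine is Stewart–Yu's
linear-forms-in-logarithms product) and it does not beat it: for k = 3 PencilBound IS the barrier's
exponent 1/3 (consistent with stewart_yu / BakerMethodBoundsEpsShape); for k ≥ 4 the exponent drops
to 1/k only because the radical of k − 3 FURTHER members is charged — the barrier quantifies over
all abc triples with rad(abc) alone and does not cover a locus statement; no claim improves
exp(κ·rad^(1/3)(log rad)³) for bare triples.
- Literature.Barriers.ABC.EpsilonCannotBeDropped: PencilBound and the class theorem keep +ε and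
C(ε); no ε-free claim.
- Literature.Barriers.ABC.BakerShapeConstantFloor: not engaged (no claim on Baker-shape constants;
the ground field ℚ is fixed — this is how the line evades the g0–g2 wall B-LFL×DIVFIELD: no division
field enters).
- Literature.Barriers.ABC.ExplicitABCQualityFloor: not engaged; HallExponentSharp /
NConjectureExponentSharp likewise (no quality or Hall-type claim; constants unspecified).
- Negatives index: steers around every refuted ABC statement at filing (ledger negatives --problem
ABC: spectral/Parseval positivity, exponent-free or uniform-constant claims, EpsShapeBound below 1/3
for ALL triples — PencilBound at k = 3 is exactly 1/3, below 1/3 only for k ≥ 4 members with their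
radical charged; ε and C(ε) kept).

sub-problem: ABC · status: draft · opened planner-abc-idea-1-g4-0 2026-08-28T02:18:21Z · rev 0 · ledger route-ABC-TwoSixPencil
GENERATED by the gate from the ledger (D-0016/17). Provers cite these decls: `theorem foo : Summit.ABC.ABC.Theses.TwoSixPencil.<Decl> := …` in Summits/ABC/ABC/Theorems/<Name>.lean.
-/

namespace Summit.ABC.ABC.Theses.TwoSixPencil

open scoped BigOperators Topology Manifold Classical MeasureTheory ProbabilityTheory Matrix InnerProductSpace ComplexConjugate ContinuousMap
open Filter Set Function TopologicalSpace MeasureTheory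

attribute [summit_statement] _root_.ABC

open Literature.Abc

/-- item stmt-ABC-24781 · target · rank 0 · closed · proved by Summit.ABC.ABC.Theorems.twoSixClassEpsShape_proof (prover) · by planner
why it might fail: only through the items below: a cusp prime p ≥ 5 at which W(u,w) were additive or non-minimal (excluded: c₄-resultants are w⁸ times 2,3-units, job j296935), or a mis-normalised sub-triple in the pencil engine; samples (2,1),(11,4) have torsion [6,2] and rad F | 6N.
sources: Kubert1976, StewartYu2001, arXiv:2001.01016, arXiv:2407.13850
[target] Szpiro's conjecture in ε-shape with exponent 1/6 for every elliptic curve over ℚ with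
torsion subgroup containing ℤ/2×ℤ/6, stated on the integral Kubert model W(u,w) = ⟨u²+2uw−19w²,
2w(u−5w)(u−w)², 2w(u−5w)(u−w)²(u−3w)(u+3w), 0, 0⟩ with gcd(u,w) = 1 and F(u,w) ≠ 0 (every such curve
is ℚ-isomorphic to one W(u,w), Kubert1976 Table 3 — semantic, not load-bearing). -/
@[route_item "route-ABC-TwoSixPencil"]
def TwoSixClassEpsShape : Prop :=
  ∀ ε : ℝ, 0 < ε → ∃ C : ℝ, ∀ u w : ℤ, IsCoprime u w → w * (u - w) * (u - 3 * w) * (u + 3 * w) * (u - 5 * w) * (u - 9 * w) ≠ 0 → ∀ (W : WeierstrassCurve ℚ) [W.IsElliptic], W = ⟨((u ^ 2 + 2 * u * w - 19 * w ^ 2 : ℤ) : ℚ), ((2 * w * (u - 5 * w) * (u - w) ^ 2 : ℤ) : ℚ), ((2 * w * (u - 5 * w) * (u - w) ^ 2 * (u - 3 * w) * (u + 3 * w) : ℤ) : ℚ), 0, 0⟩ → Real.log (W.minimalDiscriminantNorm ℤ : ℝ) ≤ C * (W.conductorNorm ℤ : ℝ) ^ (1 / 6 + ε : ℝ)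

-- `TwoSixClassEpsShape` holds: proved by `Summit.ABC.ABC.Theorems.twoSixClassEpsShape_proof` (its module imports this route file, so no `_holds` link can be stated here).

/-- item stmt-ABC-24782 · crux · rank 2 · closed · proved by Summit.ABC.ABC.Theorems.pencilBound_proof (prover) · by planner
why it might fail: Low risk (corollary of the PROVED Thm 2), all in the Fin k bookkeeping: each member needs a 3-term identity with bounded gcd (divides a resultant product), sign/z>2 normalisation with max(|u|,|w|) ≤ c·z, and P(rescaled member) ≤ max(P(res), P(L_i)).
sources: StewartYu2001, GyoryYu2006, EvertseGyory2015, Sheppard2016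
[crux] THE GENERAL PENCIL THEOREM (abc side, integers only): for every k ≥ 3, all integer
coefficient vectors a, b : Fin k → ℤ with the forms L_i = a_i u + b_i w pairwise non-proportional,
and every ε > 0, there is C with log max(|u|,|w|) ≤ C·rad(∏_i L_i(u,w))^(1/k+ε) for all coprime u, w
with ∏ L_i(u,w) ≠ 0 (card items K1/K1′ in one statement; k = 3 is the tree's EpsShapeBound(1/3), k =
4 is PencilFourBound of route RationalCuspPencil). [difficulty: M] -/
@[route_item "route-ABC-TwoSixPencil", crux (experiment := "instrument: KEY batch 58 pr-4 PENCIL-ENGINE 77ef51280013ac9a (never the residual 24550); pr-4 g4 EMITTED 02:45Z and ARRIVED 02:47Z (general engine land…") (source := "director LADDER-ABC l.329, 2026-09-01")]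
def PencilBound : Prop :=
  ∀ (k : ℕ) (a b : Fin k → ℤ), 3 ≤ k → (∀ i j, i ≠ j → a i * b j ≠ a j * b i) → ∀ ε : ℝ, 0 < ε → ∃ C : ℝ, ∀ u w : ℤ, IsCoprime u w → (∏ i, (a i * u + b i * w)) ≠ 0 → Real.log ((max |u| |w| : ℤ) : ℝ) ≤ C * (((UniqueFactorizationMonoid.radical (∏ i, (a i * u + b i * w))).natAbs : ℕ) : ℝ) ^ (1 / (k : ℝ) + ε)

-- `PencilBound` holds: proved by `Summit.ABC.ABC.Theorems.pencilBound_proof` (its module imports this route file, so no `_holds` link can be stated here).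

/-- item stmt-ABC-24783 · crux · rank 3 · open · by planner
why it might fail: It is abc itself modulo a provable class lemma: every catalogued barrier (BakerMethodBounds, EpsilonCannotBeDropped) stands in front of it; honest label RESIDUAL = the summit, open.
sources: MurtyPasten2013, StewartYu2001
[crux] DECLARED RESIDUAL (never claimed, exempt from staffing credit): the abc conjecture given the
ℤ/2×ℤ/6 class theorem — abc off the class. Booked so that the deciding theorem reaches the Statement
decl; to be narrowed to the ε-column rung for elliptic curves (SzpiroExponentBelowOne /
SzpiroEpsShape (1/6)) off the class once that rung is a registered closer. [deps:
TwoSixClassEpsShape] [difficulty: open-problem] -/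
@[route_item "route-ABC-TwoSixPencil", crux]
def TwoSixResidual : Prop :=
  TwoSixClassEpsShape → _root_.ABC

/-- item stmt-ABC-24784 · support · rank 9 · closed · proved by Summit.ABC.ABC.Theorems.twoSixDictionary_proof (prover) · by planner
sources: SilvermanAEC2009, Kubert1976, arXiv:2001.01016
[support] THE ℤ/2×ℤ/6 DICTIONARY (Tate's algorithm away from 6 on the Kubert model): for coprime u,
w with F(u,w) ≠ 0 and W = W(u,w) elliptic, |Δ_min(W)| ≤ |64·w⁶(u−w)⁶(u−3w)²(u+3w)²(u−5w)⁶(u−9w)²| (=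
|Δ(W)|, exact identity, job j296935) and rad F ∣ 6·N_W (p ≥ 5, p | L_i ⇒ p ∤ c₄ since Res_u(c₄, L_i)
= ±2^a3^b·w⁸ and c₄(u,0) = u⁸ ⇒ minimal, multiplicative, f_p = 1: tree lemma
WeierstrassCurve.conductorExponent_eq_one_of_dvd_Δ_of_not_dvd_c₄; integral model ⇒ |Δ_min| ≤ |Δ| as
in twoTorsionDictionary_proof). [difficulty: provable-now] -/
@[route_item "route-ABC-TwoSixPencil", crux]
def TwoSixDictionary : Prop :=
  ∀ u w : ℤ, IsCoprime u w → w * (u - w) * (u - 3 * w) * (u + 3 * w) * (u - 5 * w) * (u - 9 * w) ≠ 0 → ∀ (W : WeierstrassCurve ℚ) [W.IsElliptic], W = ⟨((u ^ 2 + 2 * u * w - 19 * w ^ 2 : ℤ) : ℚ), ((2 * w * (u - 5 * w) * (u - w) ^ 2 : ℤ) : ℚ), ((2 * w * (u - 5 * w) * (u - w) ^ 2 * (u - 3 * w) * (u + 3 * w) : ℤ) : ℚ), 0, 0⟩ → (W.minimalDiscriminantNorm ℤ : ℝ) ≤ |(((64 * (w ^ 6 * (u - w) ^ 6 * (u - 3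 * w) ^ 2 * (u + 3 * w) ^ 2 * (u - 5 * w) ^ 6 * (u - 9 * w) ^ 2) : ℤ)) : ℝ)| ∧ (UniqueFactorizationMonoid.radical (w * (u - w) * (u - 3 * w) * (u + 3 * w) * (u - 5 * w) * (u - 9 * w))).natAbs ∣ 6 * W.conductorNorm ℤ

-- `TwoSixDictionary` holds: proved by `Summit.ABC.ABC.Theorems.twoSixDictionary_proof` (its module imports this route file, so no `_holds` link can be stated here).

/-- item stmt-ABC-24785 · support · rank 9 · closed · proved by Summit.ABC.ABC.Theorems.twoSixPayoff_proof (prover) · by planner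
sources: StewartYu2001, SilvermanAEC2009
[support] PAYOFF (real-analysis glue): PencilBound at k = 6 with a = (0,1,1,1,1,1), b =
(1,−1,−3,3,−5,−9) (Fin.prod_univ_six identifies ∏ L_i with F) and the dictionary give the class
theorem: log|Δ_min| ≤ log 64 + 24·(log 10 + log max(|u|,|w|)) ≤ c + 24·C·(6 N_W)^(1/6+ε) ≤
C'·N_W^(1/6+ε) (N_W ≥ 1). [difficulty: provable-now] -/
@[route_item "route-ABC-TwoSixPencil", crux]
def TwoSixPayoff : Prop :=
  PencilBound → TwoSixDictionary → TwoSixClassEpsShape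

-- `TwoSixPayoff` holds: proved by `Summit.ABC.ABC.Theorems.twoSixPayoff_proof` (its module imports this route file, so no `_holds` link can be stated here).

/-- item stmt-ABC-24786 · assembly · rank 1 · closed · proved by Summit.ABC.ABC.Theorems.twoSixPencil_assembly_proof (prover) · by planner
sources: StewartYu2001, Kubert1976
[assembly] PencilBound → TwoSixDictionary → TwoSixPayoff → TwoSixResidual → abc (pure logic; the
deciding theorem `closes` in glue.lean is the certified form). -/
@[route_item "route-ABC-TwoSixPencil"]
def Assembly : Prop :=
  PencilBound → TwoSixDictionary → TwoSixPayoff → TwoSixResidual → _root_.ABC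

-- `Assembly` holds: proved by `Summit.ABC.ABC.Theorems.twoSixPencil_assembly_proof` (its module imports this route file, so no `_holds` link can be stated here).

/-! D-0027 §2.1 — DECIDING THEOREM (planner-authored via `route open/edit --closes-file`; by planner-abc-idea-1-g4-0 2026-08-28T02:18:21Z):
its hypotheses are this route's items and its conclusion the sub-problem Statement (glue_lint), and it elaborates with this file. -/

@[closes "route-ABC-TwoSixPencil"] theorem closes (h₁ : PencilBound) (h₂ : TwoSixDictionary) (h₃ : TwoSixPayoff)
    (h₄ : TwoSixResidual) : _root_.ABC :=
  h₄ (h₃ h₁ h₂)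

end Summit.ABC.ABC.Theses.TwoSixPencil
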